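import Literature.Algebra.Homology.DiscreteRepLayerInflation
import Literature.Algebra.Homology.ExtMapExactFunctorNaturality
import HarnessLib

/-!
# Transition between two finite layers `V ≤ U` on `Ext`: `Extⁿ_{Γ⧸U}(k, M^U) → Extⁿ_{Γ⧸V}(k, M^V)` and
# the triangle `extInf_V ∘ t_{UV} = extInf_U`

Topic `Algebra/Homology`; namespace `Literature.Algebra.Homology.DiscreteRep`.  Definitions with bodies
and theorems; no named fact, no `sorry`, no instance.  Sequel of `DiscreteRepLayerInflation` (door-c4
g14: `extInf U hU M n : Ext (Rep.trivial k (Γ⧸U) k) (M^U) n →+ Ext (triv k) M n`) and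
`ExtMapExactFunctorNaturality` (`mapExactFunctor_comp_functor`).  Written for Route A of the
Poitou–Tate programme of crux `stmt-BirchSwinnertonDyer-19295` (cell `bsd-schneider-ideate`, seat
door-c4 gen 14), item (d): the DIRECT SYSTEM `U ↦ Extⁿ_{Rep k (Γ⧸U)}(k, M^U)` over the open normal
subgroups, whose colimit is to be `Extⁿ_{C_Γ}(k, M)` (Serre, *Galois Cohomology* I §2.2 Prop. 8).

For open normal subgroups `V ≤ U` of `Γ`:
* `quotMap U V hVU : Γ ⧸ V →* Γ ⧸ U`, the exact restriction `layerRes k U V hVU : Rep k (Γ⧸U) ⥤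
  Rep k (Γ⧸V)` (Mathlib `Rep.resFunctor`), `layerRes_trivial` (`rfl`), `layerRes_comp_infFunctor`
  (`layerRes ⋙ Inf_V = Inf_U`, `rfl`);
* `invariantsStepIncl U V hVU M : layerRes (M^U) ⟶ M^V` (the inclusion `M^U ⊆ M^V`),
  `infFunctor_map_invariantsStepIncl_comp` (`Inf_V(incl_{UV}) ≫ incl_V = incl_U`);
* **`extInfStep U V hU hV hVU M n : Ext (𝟙_{Γ⧸U}) (M^U) n →+ Ext (𝟙_{Γ⧸V}) (M^V) n`**
  (`y ↦ Res(y) ≫ incl_{UV}`) and **`extInf_extInfStep : extInf V (extInfStep y) = extInf U y`**;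
* `extInfStep_naturality` (in `M`).

HONEST FRAMING: homological algebra only.

## References
* J.-P. Serre, *Galois Cohomology*, Springer (1997), I §2.2 Proposition 8. [SerreGaloisCohomology1997]
* D. Harari, *Galois Cohomology and Class Field Theory* (2020), §4.3 Proposition 4.18, Remark 4.24.
  [Harari2020]
-/

noncomputable section

universe u

namespace Literature.Algebra.Homology

namespace DiscreteRep

open CategoryTheory CategoryTheory.Limits CategoryTheory.Abelian

variable {k Γ : Type u} [CommRing k] [Group Γ] [TopologicalSpace Γ] [IsTopologicalGroup Γ]
  (U V : Subgroup Γ) [U.Normal] [V.Normal] (hU : IsOpen (U : Set Γ)) (hV : IsOpen (V : Set Γ))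
  (hVU : V ≤ U)

/-! ## §1 The restriction `Rep k (Γ⧸U) ⥤ Rep k (Γ⧸V)` along `Γ⧸V → Γ⧸U` -/

/-- The quotient map `Γ⧸V → Γ⧸U` for `V ≤ U`. [cite: SerreGaloisCohomology1997, I §2.2 Proposition 8] -/
def quotMap : Γ ⧸ V →* Γ ⧸ U := QuotientGroup.map V U (MonoidHom.id Γ) hVU

omit [TopologicalSpace Γ] [IsTopologicalGroup Γ] in
/-- `quotMap (mk γ) = mk γ`. [cite: SerreGaloisCohomology1997, I §2.2 Proposition 8] -/
@[simp]
theorem quotMap_mk (γ : Γ) : quotMap U V hVU (QuotientGroup.mk γ) = QuotientGroup.mk γ := rfl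

variable (k) in
/-- **Inflation between two finite layers**: the restriction `Rep k (Γ⧸U) ⥤ Rep k (Γ⧸V)` along
`Γ⧸V → Γ⧸U` (Mathlib `Rep.resFunctor`; exact). [cite: SerreGaloisCohomology1997, I §2.2 Proposition 8] -/
abbrev layerRes : Rep.{u} k (Γ ⧸ U) ⥤ Rep.{u} k (Γ ⧸ V) := Rep.resFunctor (quotMap U V hVU)

omit [TopologicalSpace Γ] [IsTopologicalGroup Γ] in
/-- The restriction of the trivial representation is trivial (definitionally).
[cite: SerreGaloisCohomology1997, I §2.2 Proposition 8] -/
theorem layerRes_trivial (W : Type u) [AddCommGroup W] [Module k W] :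
    (layerRes k U V hVU).obj (Rep.trivial k (Γ ⧸ U) W) = Rep.trivial k (Γ ⧸ V) W := rfl

/-- **`layerRes ⋙ Inf_V = Inf_U`** (definitionally: both are restriction along `Γ → Γ⧸U`).
[cite: SerreGaloisCohomology1997, I §2.2 Proposition 8] -/
theorem layerRes_comp_infFunctor : layerRes k U V hVU ⋙ infFunctor k V hV = infFunctor k U hU := rfl

/-! ## §2 The inclusion `M^U ⊆ M^V` and the transition on `Ext` -/

include hVU in
omit [V.Normal] [IsTopologicalGroup Γ] in
/-- An element of `M^U` is `V`-invariant for `V ≤ U`. [cite: SerreGaloisCohomology1997, I §2.2 Proposition 8] -/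
theorem mem_invariants_of_le (M : DiscreteRepCat k Γ) (x : (M.obj.quotientToInvariants U).V) :
    (x.1 : M.obj.V) ∈ Representation.invariants (M.obj.ρ.comp V.subtype) := fun v =>
  x.2 ⟨v.1, hVU v.2⟩

/-- **The inclusion `M^U ⊆ M^V`** as a morphism `layerRes (M^U) ⟶ M^V` of `Rep k (Γ⧸V)`.
[cite: SerreGaloisCohomology1997, I §2.2 Proposition 8] -/
def invariantsStepIncl (M : DiscreteRepCat k Γ) :
    (layerRes k U V hVU).obj ((invariantsQuotFunctor k U).obj M) ⟶ (invariantsQuotFunctor k V).obj M :=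
  Rep.ofHom
    ⟨{ toFun := fun x => ⟨x.1, mem_invariants_of_le U V hVU M x⟩
       map_add' := fun _ _ => rfl
       map_smul' := fun _ _ => rfl },
     fun q => QuotientGroup.induction_on q fun _ => LinearMap.ext fun _ => Subtype.ext rfl⟩

omit [IsTopologicalGroup Γ] in
/-- Formula: `invariantsStepIncl` is `x ↦ x` on underlying vectors.
[cite: SerreGaloisCohomology1997, I §2.2 Proposition 8] -/
@[simp]
theorem invariantsStepIncl_hom_apply_coe (M : DiscreteRepCat k Γ) (x : (M.obj.quotientToInvariants U).V) :
    ((invariantsStepIncl U V hVU M).hom x).1 = x.1 := rfl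

omit [IsTopologicalGroup Γ] in
/-- Naturality of `invariantsStepIncl` in `M`. [cite: SerreGaloisCohomology1997, I §2.2 Proposition 8] -/
theorem layerRes_map_invariantsStepIncl {M M' : DiscreteRepCat k Γ} (g : M ⟶ M') :
    (layerRes k U V hVU).map ((invariantsQuotFunctor k U).map g) ≫ invariantsStepIncl U V hVU M' =
      invariantsStepIncl U V hVU M ≫ (invariantsQuotFunctor k V).map g :=
  Rep.hom_ext (DFunLike.ext _ _ fun _ => Subtype.ext rfl)

/-- **`Inf_V(incl_{UV}) ≫ incl_V = incl_U`** (all inclusions into `M`).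
[cite: SerreGaloisCohomology1997, I §2.2 Proposition 8] -/
theorem infFunctor_map_invariantsStepIncl_comp (M : DiscreteRepCat k Γ) :
    (infFunctor k V hV).map (invariantsStepIncl U V hVU M) ≫ invariantsIncl V hV M =
      invariantsIncl U hU M :=
  ObjectProperty.hom_ext _ (Rep.hom_ext (DFunLike.ext _ _ fun _ => rfl))

/-- **The transition `Extⁿ_{Γ⧸U}(k, M^U) →+ Extⁿ_{Γ⧸V}(k, M^V)`**: `y ↦ Res_{Γ⧸V → Γ⧸U}(y) ≫ incl_{UV}`.
[cite: SerreGaloisCohomology1997, I §2.2 Proposition 8] -/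
def extInfStep (M : DiscreteRepCat k Γ) (n : ℕ) :
    Ext (Rep.trivial k (Γ ⧸ U) k) ((invariantsQuotFunctor k U).obj M) n →+
      Ext (Rep.trivial k (Γ ⧸ V) k) ((invariantsQuotFunctor k V).obj M) n :=
  ((Ext.mk₀ (invariantsStepIncl U V hVU M)).postcomp _ (add_zero n)).comp
    ((layerRes k U V hVU).mapExtAddHom _ _ n)

omit [IsTopologicalGroup Γ] in
/-- Formula for `extInfStep`. [cite: SerreGaloisCohomology1997, I §2.2 Proposition 8] -/
theorem extInfStep_apply (M : DiscreteRepCat k Γ) (n : ℕ)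
    (y : Ext (Rep.trivial k (Γ ⧸ U) k) ((invariantsQuotFunctor k U).obj M) n) :
    extInfStep U V hVU M n y =
      (y.mapExactFunctor (layerRes k U V hVU)).comp (Ext.mk₀ (invariantsStepIncl U V hVU M))
        (add_zero n) := rfl

/-- **The triangle `extInf_V ∘ t_{UV} = extInf_U`.** [cite: SerreGaloisCohomology1997, I §2.2 Proposition 8] -/
theorem extInf_extInfStep (M : DiscreteRepCat k Γ) (n : ℕ)
    (y : Ext (Rep.trivial k (Γ ⧸ U) k) ((invariantsQuotFunctor k U).obj M) n) :
    extInf V hV M n (extInfStep U V hVU M n y) = extInf U hU M n y := by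
  change (((y.mapExactFunctor (layerRes k U V hVU)).comp (Ext.mk₀ (invariantsStepIncl U V hVU M))
      (add_zero n)).mapExactFunctor (infFunctor k V hV)).comp (Ext.mk₀ (invariantsIncl V hV M))
      (add_zero n) =
    (y.mapExactFunctor (infFunctor k U hU)).comp (Ext.mk₀ (invariantsIncl U hU M)) (add_zero n)
  haveI := comp_preservesFiniteLimits (layerRes k U V hVU) (infFunctor k V hV)
  haveI := comp_preservesFiniteColimits (layerRes k U V hVU) (infFunctor k V hV)
  rw [Ext.mapExactFunctor_comp, Ext.mapExactFunctor_mk₀, Ext.comp_assoc_of_third_deg_zero,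
    Ext.mk₀_comp_mk₀, ← ExtFunctoriality.mapExactFunctor_comp_functor]
  rfl

omit [IsTopologicalGroup Γ] in
/-- Naturality of `extInfStep` in `M`. [cite: SerreGaloisCohomology1997, I §2.2 Proposition 8] -/
theorem extInfStep_naturality {M M' : DiscreteRepCat k Γ} (g : M ⟶ M') (n : ℕ)
    (y : Ext (Rep.trivial k (Γ ⧸ U) k) ((invariantsQuotFunctor k U).obj M) n) :
    extInfStep U V hVU M' n (y.comp (Ext.mk₀ ((invariantsQuotFunctor k U).map g)) (add_zero n)) =
      (extInfStep U V hVU M n y).comp (Ext.mk₀ ((invariantsQuotFunctor k V).map g)) (add_zero n) := by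
  rw [extInfStep_apply, extInfStep_apply, Ext.mapExactFunctor_comp, Ext.mapExactFunctor_mk₀,
    Ext.comp_assoc_of_third_deg_zero, Ext.mk₀_comp_mk₀, layerRes_map_invariantsStepIncl,
    ← Ext.mk₀_comp_mk₀]
  exact (Ext.comp_assoc_of_second_deg_zero _ _ _ _).symm

end DiscreteRep

end Literature.Algebra.Homology
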